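import Mathlib.Algebra.Order.Floor.Defs
import Mathlib.Algebra.Order.Floor.Ring
import Mathlib.Algebra.Order.Field.Basic
import Mathlib.Algebra.Ring.Parity
import Mathlib.Data.Rat.Floor
import Mathlib.Order.Interval.Finset.Nat
import Mathlib.Tactic.Linarith
import Mathlib.Tactic.Positivity
import Mathlib.Tactic.Ring
import Mathlib.Tactic.FieldSimp
import HarnessLib

/-!
# IEEE SA P3109 finite-random-bit stochastic rounding modes (StochasticA/B/C)

Source: A. Fitzgibbon, C. M. Wintersteiger, J. Sarnoff, *Novel Aspects of IEEE SA P3109 Arithmetic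
Formats for Machine Learning* (2026), arXiv:2606.04028 [FitzgibbonWintersteigerSarnoff2026], §III-A
and Fig. 2 (p. 4). Verbatim (Fig. 2): "Auxiliary function RoundAway takes the rounding mode and
truncated fraction `η = S − ⌊S⌋` to determine whether to round away from zero. Stochastic rounding modes
are explicitly supplied with random bits `0 ≤ R < 2^N`." and the three rows
`StochasticA_{N,R} → ⌊η × 2^N⌋ + R ≥ 2^N`, `StochasticB_{N,R} → ⌊η × 2^(N+1)⌋ + (2 × R + 1) ≥ 2^(N+1)`,
`StochasticC_{N,R} → RNITE(η × 2^N) + R ≥ 2^N`, with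
`RNITE(X) = ⌊X⌋ if X < ⌊X⌋ + 0.5; ⌊X⌋ + 1 if X > ⌊X⌋ + 0.5; ⌊X⌋ + IsOdd(⌊X⌋)` (otherwise).

This file records ONLY the published notions — the three decision predicates and `RNITE` — as
cite-tagged definitions (plus their decidability instances). The elementary counting consequences
(`2^N · P(away) = ⌊η 2^N⌋`, `⌊η 2^N + 1/2⌋`, `RNITE(η 2^N)` for `0 ≤ η < 1`) and the resulting
per-step / n-step bias bounds are NEW work and live in the venture tree
(`Summits/Ventures/CertifiedArithmetic/LowPrec/SRLimitedBits.lean`). The infinite-randomness limit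
`P(away) = η` is mode-2 stochastic rounding (`Literature.ComputerArithmetic.ConnollyHighamMary2021`);
the average-bias analysis of these modes (SRFF/SRF/SRC) is Fitzgibbon–Felix, ARITH 2025
(arXiv:2504.20634). No claim about any implementation.
-/

namespace Literature.ComputerArithmetic.P3109

variable {K : Type*} [Field K] [LinearOrder K] [IsStrictOrderedRing K] [FloorRing K]

/-- [cite: FitzgibbonWintersteigerSarnoff2026, Fig. 2] `RNITE(X)`: round to nearest integer, ties to
even — `⌊X⌋` if `X < ⌊X⌋ + 1/2`, `⌊X⌋ + 1` if `X > ⌊X⌋ + 1/2`, else `⌊X⌋ + IsOdd(⌊X⌋)`. -/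
def rnite (X : K) : ℤ :=
  if X < ⌊X⌋ + 1 / 2 then ⌊X⌋
  else if (⌊X⌋ : K) + 1 / 2 < X then ⌊X⌋ + 1
  else ⌊X⌋ + (if Odd ⌊X⌋ then 1 else 0)

/-- [cite: FitzgibbonWintersteigerSarnoff2026, Fig. 2] `StochasticA_{N,R}`: with truncated fraction
`η` and random bits `0 ≤ R < 2^N`, round AWAY from zero iff `⌊η × 2^N⌋ + R ≥ 2^N`. -/
def StochasticA (N R : ℕ) (η : K) : Prop := (2 : ℤ) ^ N ≤ ⌊η * 2 ^ N⌋ + R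

/-- [cite: FitzgibbonWintersteigerSarnoff2026, Fig. 2] `StochasticB_{N,R}`: round away from zero iff
`⌊η × 2^(N+1)⌋ + (2 × R + 1) ≥ 2^(N+1)`. -/
def StochasticB (N R : ℕ) (η : K) : Prop := (2 : ℤ) ^ (N + 1) ≤ ⌊η * 2 ^ (N + 1)⌋ + (2 * R + 1)

/-- [cite: FitzgibbonWintersteigerSarnoff2026, Fig. 2] `StochasticC_{N,R}`: round away from zero iff
`RNITE(η × 2^N) + R ≥ 2^N`. -/
def StochasticC (N R : ℕ) (η : K) : Prop := (2 : ℤ) ^ N ≤ rnite (η * 2 ^ N) + R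

/-- [folklore] `StochasticA` is a decidable predicate (integer comparison; instance plumbing). -/
instance instDecidableStochasticA (N R : ℕ) (η : K) : Decidable (StochasticA N R η) := by
  unfold StochasticA; infer_instance

/-- [folklore] `StochasticB` is a decidable predicate (integer comparison; instance plumbing). -/
instance instDecidableStochasticB (N R : ℕ) (η : K) : Decidable (StochasticB N R η) := by
  unfold StochasticB; infer_instance

/-- [folklore] `StochasticC` is a decidable predicate (integer comparison; instance plumbing). -/
instance instDecidableStochasticC (N R : ℕ) (η : K) : Decidable (StochasticC N R η) := by
  unfold StochasticC; infer_instance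

end Literature.ComputerArithmetic.P3109
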